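import Mathlib
import Summits.Ventures.PercRepro2.K5StarGenPerm

/-!
# THE DISPATCH: `StarCertsGen` FROM THE SORTED STAR LISTS (blind cell PercRepro2, mine-2 g41,
2026-08-29; `proofs/MINE2-GENSTAR.md` §5)

p2's hypothesis `StarCertsGen R` (TypedStarGenCore.lean) quantifies over every star list of distinct
marks with types in `{1, 2}` and at least four edges, at the three markings `b ∈ {4, 3, 0}`.  By the
symmetry of the placement sum (`K5StarGenPerm.lean`) the SORTED lists suffice: at `b = 4` the sorted
`4`-lists `[(q₁, t₁), …, (q₄, t₄)]` with `q₁ < q₂ < q₃ < q₄` and the `5`-list `[(0, t₁), …, (4, t₅)]`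
(`SortedCerts4`, `SortedCerts5`); at `b = 3` and `b = 0` the marks are `{0, 1, 2, 3}` and only the
`4`-list `[(0, t₁), …, (3, t₄)]` occurs (`SortedCerts3`, `SortedCerts0`).  **`starCertsGen_of_sorted`**:
the four sorted families give `StarCertsGen R` — a list is sorted by `List.insertionSort` on the marks,
its length is `4` or `5` (distinct marks in `Fin 5`), and the sorted list is one of the families.

Own code; standard axioms.
-/

namespace Summit.Ventures.PercRepro2

open Hub

namespace K5

section Sorted

variable (R : Type*) [Field R] [LinearOrder R]

/-- The sorted `4`-lists at `b = 4`. -/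
def SortedCerts4 : Prop :=
  ∀ (q₁ q₂ q₃ q₄ : Fin 5), q₁ < q₂ → q₂ < q₃ → q₃ < q₄ → ∀ t₁ t₂ t₃ t₄ : ℕ,
    (t₁ = 1 ∨ t₁ = 2) → (t₂ = 1 ∨ t₂ = 2) → (t₃ = 1 ∨ t₃ = 2) → (t₄ = 1 ∨ t₄ = 2) →
    StarNonnegGen R 0 1 2 3 4 [(q₁, t₁), (q₂, t₂), (q₃, t₃), (q₄, t₄)]

/-- The `5`-list at `b = 4`. -/
def SortedCerts5 : Prop :=
  ∀ t₁ t₂ t₃ t₄ t₅ : ℕ, (t₁ = 1 ∨ t₁ = 2) → (t₂ = 1 ∨ t₂ = 2) → (t₃ = 1 ∨ t₃ = 2) →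
    (t₄ = 1 ∨ t₄ = 2) → (t₅ = 1 ∨ t₅ = 2) →
    StarNonnegGen R 0 1 2 3 4 [(0, t₁), (1, t₂), (2, t₃), (3, t₄), (4, t₅)]

/-- The `4`-list at `b = 3`. -/
def SortedCerts3 : Prop :=
  ∀ t₁ t₂ t₃ t₄ : ℕ, (t₁ = 1 ∨ t₁ = 2) → (t₂ = 1 ∨ t₂ = 2) → (t₃ = 1 ∨ t₃ = 2) → (t₄ = 1 ∨ t₄ = 2) →
    StarNonnegGen R 0 1 2 3 3 [(0, t₁), (1, t₂), (2, t₃), (3, t₄)]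

/-- The `4`-list at `b = 0`. -/
def SortedCerts0 : Prop :=
  ∀ t₁ t₂ t₃ t₄ : ℕ, (t₁ = 1 ∨ t₁ = 2) → (t₂ = 1 ∨ t₂ = 2) → (t₃ = 1 ∨ t₃ = 2) → (t₄ = 1 ∨ t₄ = 2) →
    StarNonnegGen R 0 1 2 3 0 [(0, t₁), (1, t₂), (2, t₃), (3, t₄)]

end Sorted

section Dispatch

variable {R : Type*} [Field R] [LinearOrder R]

/-- The order on star edges by mark. -/
def byMark (x y : Fin 5 × ℕ) : Prop := x.1 ≤ y.1

/-- A list of star edges sorted by mark with distinct marks has strictly increasing marks. -/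
lemma lt_of_pairwise_nodup {x y : Fin 5 × ℕ} {l : List (Fin 5 × ℕ)}
    (hp : (x :: y :: l).Pairwise byMark) (hn : ((x :: y :: l).map Prod.fst).Nodup) : x.1 < y.1 := by
  rw [List.pairwise_cons] at hp
  have h1 : byMark x y := hp.1 y (List.mem_cons_self)
  have h2 : x.1 ≠ y.1 := by
    simp only [List.map_cons, List.nodup_cons, List.mem_cons, List.mem_map, not_or] at hn
    exact fun h => hn.1.1 h
  exact lt_of_le_of_ne h1 h2

/-- Sorted by mark: the tail. -/
lemma pairwise_tail {x : Fin 5 × ℕ} {l : List (Fin 5 × ℕ)} (hp : (x :: l).Pairwise byMark) :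
    l.Pairwise byMark := (List.pairwise_cons.1 hp).2

/-- Distinct marks: the tail. -/
lemma nodup_tail {x : Fin 5 × ℕ} {l : List (Fin 5 × ℕ)} (hn : ((x :: l).map Prod.fst).Nodup) :
    (l.map Prod.fst).Nodup := by
  simp only [List.map_cons, List.nodup_cons] at hn
  exact hn.2

/-- **The sorted lists at `b = 4` cover every list.** -/
theorem starNonnegGen4_of_sorted (h4 : SortedCerts4 R) (h5 : SortedCerts5 R) (L : List (Fin 5 × ℕ))
    (hL : ∀ x ∈ L, x.2 = 1 ∨ x.2 = 2) (hnd : (L.map Prod.fst).Nodup) (hlen : 4 ≤ L.length) :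
    StarNonnegGen R 0 1 2 3 4 L := by
  letI : DecidableRel byMark := fun x y => inferInstanceAs (Decidable (x.1 ≤ y.1))
  haveI : Std.Total byMark := ⟨fun a b => le_total a.1 b.1⟩
  haveI : IsTrans (Fin 5 × ℕ) byMark := ⟨fun a b c hab hbc => le_trans hab hbc⟩
  set L' := List.insertionSort byMark L with hL'
  have hperm : L'.Perm L := List.perm_insertionSort byMark L
  refine StarNonnegGen.of_perm hperm.symm ?_
  have hpair : L'.Pairwise byMark := List.pairwise_insertionSort byMark L
  have hnd' : (L'.map Prod.fst).Nodup := (hperm.map Prod.fst).nodup_iff.2 hnd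
  have hL'' : ∀ x ∈ L', x.2 = 1 ∨ x.2 = 2 := fun x hx => hL x (hperm.mem_iff.1 hx)
  have hlen' : 4 ≤ L'.length := by rw [hperm.length_eq]; exact hlen
  have hcard : L'.length ≤ 5 := by
    have := hnd'.length_le_card
    simpa using this
  match L', hpair, hnd', hL'', hlen', hcard with
  | [a, b, c, d], hpair, hnd', hL'', _, _ =>
    have hab := lt_of_pairwise_nodup hpair hnd'
    have hbc := lt_of_pairwise_nodup (pairwise_tail hpair) (nodup_tail hnd')
    have hcd := lt_of_pairwise_nodup (pairwise_tail (pairwise_tail hpair)) (nodup_tail (nodup_tail hnd'))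
    have := h4 a.1 b.1 c.1 d.1 hab hbc hcd a.2 b.2 c.2 d.2 (hL'' a (by simp)) (hL'' b (by simp))
      (hL'' c (by simp)) (hL'' d (by simp))
    simpa using this
  | [a, b, c, d, e], hpair, hnd', hL'', _, _ =>
    have hab := lt_of_pairwise_nodup hpair hnd'
    have hbc := lt_of_pairwise_nodup (pairwise_tail hpair) (nodup_tail hnd')
    have hcd := lt_of_pairwise_nodup (pairwise_tail (pairwise_tail hpair)) (nodup_tail (nodup_tail hnd'))
    have hde := lt_of_pairwise_nodup (pairwise_tail (pairwise_tail (pairwise_tail hpair)))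
      (nodup_tail (nodup_tail (nodup_tail hnd')))
    have ha : a.1 = 0 := by omega
    have hb : b.1 = 1 := by omega
    have hc : c.1 = 2 := by omega
    have hd : d.1 = 3 := by omega
    have he : e.1 = 4 := by omega
    have := h5 a.2 b.2 c.2 d.2 e.2 (hL'' a (by simp)) (hL'' b (by simp)) (hL'' c (by simp))
      (hL'' d (by simp)) (hL'' e (by simp))
    have ha' : a = (0, a.2) := Prod.ext ha rfl
    have hb' : b = (1, b.2) := Prod.ext hb rfl
    have hc' : c = (2, c.2) := Prod.ext hc rfl
    have hd' : d = (3, d.2) := Prod.ext hd rfl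
    have he' : e = (4, e.2) := Prod.ext he rfl
    rw [ha', hb', hc', hd', he']
    exact this
  | [], _, _, _, hlen', _ => exact absurd hlen' (by simp)
  | [_], _, _, _, hlen', _ => exact absurd hlen' (by simp)
  | [_, _], _, _, _, hlen', _ => exact absurd hlen' (by simp)
  | [_, _, _], _, _, _, hlen', _ => exact absurd hlen' (by simp)
  | _ :: _ :: _ :: _ :: _ :: _ :: _, _, _, _, _, hcard => exact absurd hcard (by simp)

/-- **The sorted list at the coincidences covers every list** (marks in `{0, 1, 2, 3}`). -/
theorem starNonnegGen_of_sorted4 (b : Fin 5)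
    (h : ∀ t₁ t₂ t₃ t₄ : ℕ, (t₁ = 1 ∨ t₁ = 2) → (t₂ = 1 ∨ t₂ = 2) → (t₃ = 1 ∨ t₃ = 2) →
      (t₄ = 1 ∨ t₄ = 2) → StarNonnegGen R 0 1 2 3 b [(0, t₁), (1, t₂), (2, t₃), (3, t₄)])
    (L : List (Fin 5 × ℕ)) (hL : ∀ x ∈ L, (x.1 = 0 ∨ x.1 = 1 ∨ x.1 = 2 ∨ x.1 = 3) ∧ (x.2 = 1 ∨ x.2 = 2))
    (hnd : (L.map Prod.fst).Nodup) (hlen : 4 ≤ L.length) :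
    StarNonnegGen R 0 1 2 3 b L := by
  letI : DecidableRel byMark := fun x y => inferInstanceAs (Decidable (x.1 ≤ y.1))
  haveI : Std.Total byMark := ⟨fun a b => le_total a.1 b.1⟩
  haveI : IsTrans (Fin 5 × ℕ) byMark := ⟨fun a b c hab hbc => le_trans hab hbc⟩
  set L' := List.insertionSort byMark L with hL'
  have hperm : L'.Perm L := List.perm_insertionSort byMark L
  refine StarNonnegGen.of_perm hperm.symm ?_
  have hpair : L'.Pairwise byMark := List.pairwise_insertionSort byMark L
  have hnd' : (L'.map Prod.fst).Nodup := (hperm.map Prod.fst).nodup_iff.2 hnd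
  have hL'' : ∀ x ∈ L', (x.1 = 0 ∨ x.1 = 1 ∨ x.1 = 2 ∨ x.1 = 3) ∧ (x.2 = 1 ∨ x.2 = 2) :=
    fun x hx => hL x (hperm.mem_iff.1 hx)
  have hlen' : 4 ≤ L'.length := by rw [hperm.length_eq]; exact hlen
  have hcard : L'.length ≤ 5 := by
    have := hnd'.length_le_card
    simpa using this
  match L', hpair, hnd', hL'', hlen', hcard with
  | [a, b, c, d], hpair, hnd', hL'', _, _ =>
    have hab := lt_of_pairwise_nodup hpair hnd'
    have hbc := lt_of_pairwise_nodup (pairwise_tail hpair) (nodup_tail hnd')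
    have hcd := lt_of_pairwise_nodup (pairwise_tail (pairwise_tail hpair)) (nodup_tail (nodup_tail hnd'))
    have hd4 := (hL'' d (by simp)).1
    have ha : a.1 = 0 := by omega
    have hb : b.1 = 1 := by omega
    have hc : c.1 = 2 := by omega
    have hd : d.1 = 3 := by omega
    have := h a.2 b.2 c.2 d.2 (hL'' a (by simp)).2 (hL'' b (by simp)).2 (hL'' c (by simp)).2
      (hL'' d (by simp)).2
    have ha' : a = (0, a.2) := Prod.ext ha rfl
    have hb' : b = (1, b.2) := Prod.ext hb rfl
    have hc' : c = (2, c.2) := Prod.ext hc rfl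
    have hd' : d = (3, d.2) := Prod.ext hd rfl
    rw [ha', hb', hc', hd']
    exact this
  | [a, b, c, d, e], hpair, hnd', hL'', _, _ =>
    have hab := lt_of_pairwise_nodup hpair hnd'
    have hbc := lt_of_pairwise_nodup (pairwise_tail hpair) (nodup_tail hnd')
    have hcd := lt_of_pairwise_nodup (pairwise_tail (pairwise_tail hpair)) (nodup_tail (nodup_tail hnd'))
    have hde := lt_of_pairwise_nodup (pairwise_tail (pairwise_tail (pairwise_tail hpair)))
      (nodup_tail (nodup_tail (nodup_tail hnd')))
    have he4 := (hL'' e (by simp)).1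
    exfalso
    omega
  | [], _, _, _, hlen', _ => exact absurd hlen' (by simp)
  | [_], _, _, _, hlen', _ => exact absurd hlen' (by simp)
  | [_, _], _, _, _, hlen', _ => exact absurd hlen' (by simp)
  | [_, _, _], _, _, _, hlen', _ => exact absurd hlen' (by simp)
  | _ :: _ :: _ :: _ :: _ :: _ :: _, _, _, _, _, hcard => exact absurd hcard (by simp)

/-- **`StarCertsGen` from the four sorted families.** -/
theorem starCertsGen_of_sorted (h4 : SortedCerts4 R) (h5 : SortedCerts5 R) (h3 : SortedCerts3 R)
    (h0 : SortedCerts0 R) : CovForm.TypedRed.StarCertsGen R := by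
  intro b hb L hL hnd hlen
  rcases hb with rfl | rfl | rfl
  · exact starNonnegGen4_of_sorted h4 h5 L (fun x hx => (hL x hx).2) hnd hlen
  · refine starNonnegGen_of_sorted4 3 h3 L (fun x hx => ⟨?_, (hL x hx).2⟩) hnd hlen
    rcases (hL x hx).1 with h | h | h | h | h <;> simp [h]
  · refine starNonnegGen_of_sorted4 0 h0 L (fun x hx => ⟨?_, (hL x hx).2⟩) hnd hlen
    rcases (hL x hx).1 with h | h | h | h | h <;> simp [h]

end Dispatch

end K5

end Summit.Ventures.PercRepro2
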